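import Summits.RiemannHypothesis.RiemannHypothesis.Theorems.PfPersistenceEdgeLawCuspInteriorMass

/-!
# Edge law — (R3) from a cusp modulus with interior remainder (RH-free)

Part of the pub-rhpf THEORY-2 programme (mechanism / rigidity of the Weil window bottom; no RH
claims). Gen 6 discharged the residue (R3) `D_a(t_η) = o(η)` (`HasInteriorRegularDefect`) from
the cusp modulus `HasCuspModulus a u C`. Window ground states carry interior one-sided log-cusps
at `±(a − log q)` (transported from the edge by the truncated prime shifts of the Euler–Lagrange
equation), so the hypothesis is replaced by the cusp modulus WITH REMAINDER
`HasCuspModulusWith a u C Ξ`, `IsCuspRemainder Ξ ω` (`Ξ` monotone, modulus `ω` with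
`ω(s) log(1/s) → 0`). This file proves (R3) under the corrected hypothesis:

* `windowDefectForm_weilInteriorDefect_le_with`: `D_a(t_η) ≤ cuspDefectBoundWith a C ω η`
  (near arch from the Lipschitz-in-`Θ'_η` increments, far arch + primes + pole from the mass with
  the split scale `δ = h/Λ(h)^{1/4}`; the remainder costs `(2 log(1/h) + 2K_a)·6h ω(2h) ω(2a)`,
  which is `o(h)` exactly by the Dini–log condition);
* `tendsto_cuspDefectBoundWith_div`: `cuspDefectBoundWith a C ω η / η → 0`;
* `hasInteriorRegularDefect_of_cuspModulusWith`: **cusp modulus with remainder ⇒ (R3)** (the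
  gen-6 theorem `hasInteriorRegularDefect_of_cuspModulus` is its case `Ξ = 0`);
* corollaries at differentiability windows of `ε`: the log-Pohozaev identity, the two-sided edge
  law, `WeilLogPohozaevAt a`, the `o(h)` corner energy.

Sources: E. Bombieri, *Remarks on Weil's quadratic functional in the theory of prime numbers I*,
Rend. Mat. Acc. Lincei (9) 11 (2000) §4 Thm 3, Thm 5, §6. The remainder form is this
programme's (THEORY-2g; no literature claim).
-/

set_option linter.dupNamespace false

noncomputable section

open MeasureTheory Set Filter
open scoped Topology ENNReal

namespace Summit.RiemannHypothesis.RiemannHypothesis.Theorems.PfPersistence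

open Literature.NumberTheory.LFunctions
open Summit.RiemannHypothesis.RiemannHypothesis.Theorems.EvenWinsBeyondArch
open Summit.RiemannHypothesis.RiemannHypothesis.Theorems.WeilWindowFlowWindowLipschitz

variable {a : ℝ} {u : ℝ → ℂ}

/-! ## Constants -/

namespace HasCuspModulusWith

variable {C : ℝ} {Ξ : ℝ → ℝ}

/-- Increasing the constant. [folklore] -/
theorem mono_const (hC : HasCuspModulusWith a u C Ξ) {C' : ℝ} (hCC' : C ≤ C') :
    HasCuspModulusWith a u C' Ξ := fun x y hx hxy hy ↦ by
  have h0 : 0 ≤ cuspCoord a y - cuspCoord a x := _root_.sub_nonneg.2 (cuspCoord_mono hx hxy hy)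
  exact (hC hx hxy hy).trans (by nlinarith)

/-- Without loss of generality `C ≥ 0`. [folklore] -/
theorem max_zero (hC : HasCuspModulusWith a u C Ξ) : HasCuspModulusWith a u (max C 0) Ξ :=
  hC.mono_const (le_max_left _ _)

end HasCuspModulusWith

/-- `Φ(η) ≥ 0` (`C ≥ 0`, `a > 0`, `0 < η`). [folklore] -/
theorem cuspNearRate_nonneg {C : ℝ} {Ξ ω : ℝ → ℝ} (hR : IsCuspRemainder Ξ ω) (hC0 : 0 ≤ C)
    (ha : 0 < a) {η : ℝ} (hη : 0 < η) : 0 ≤ cuspNearRate a C ω η := by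
  have hh0 := layerDepth_pos ha hη
  have h1 := hR.modulus_nonneg (show 0 ≤ 2 * layerDepth a η by linarith)
  have h2 := hR.modulus_nonneg (show 0 ≤ 2 * a by linarith)
  have h3 := cuspPrim_nonneg a (2 * layerDepth a η)
  have h4 := cuspPrim_nonneg a a
  unfold cuspNearRate
  positivity

/-- The **explicit defect bound** under a cusp modulus with remainder:
`E(η) = h Φ(η) + (2 log(1/h) + 2K_a)·(6a η² (C G(a) + ω(2a))² + 6 h ω(2h) ω(2a))
  + (2 + 2K_a)(6 C² G(a) + 96 C²)·h/q_a(η)`, `h = h(η)`, `G = cuspPrim a`,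
`Φ = cuspNearRate a C ω`. [folklore] -/
def cuspDefectBoundWith (a C : ℝ) (ω : ℝ → ℝ) (η : ℝ) : ℝ :=
  layerDepth a η * cuspNearRate a C ω η +
    (2 * Real.log (1 / layerDepth a η) + 2 * layerConstant a) *
      (6 * a * η ^ 2 * (C * cuspPrim a a + ω (2 * a)) ^ 2 +
        6 * layerDepth a η * ω (2 * layerDepth a η) * ω (2 * a)) +
    (2 + 2 * layerConstant a) * (6 * C ^ 2 * cuspPrim a a + 96 * C ^ 2) *
      (layerDepth a η / cuspRoot a η)

/-! ## The explicit bound -/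

/-- **The interior defect under a cusp modulus with remainder.** For a ground state with
`HasCuspModulusWith a u C Ξ`, `IsCuspRemainder Ξ ω`, `C ≥ 0` and `0 < η ≤ 1` with `h(η) ≤ 1/2`:
`D_a(t_η) ≤ cuspDefectBoundWith a C ω η`. Near arch (`s ≤ h`): `∫ ρ D_s(t_η) ≤ h Φ(η)`; the rest
is `≤ (2 log(1/h) + 2K_a)‖t_η‖²` with the mass bound at `δ = h/q`, `q⁴ = Λ(h)`.
[cite: Bombieri2000Weil, §4 Thm 5 (the dilation), §6] -/
theorem windowDefectForm_weilInteriorDefect_le_with (hu : IsWeilGroundState a u) {C : ℝ}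
    {Ξ ω : ℝ → ℝ} (hC : HasCuspModulusWith a u C Ξ) (hR : IsCuspRemainder Ξ ω) (hC0 : 0 ≤ C)
    {η : ℝ} (hη : 0 < η) (hη1 : η ≤ 1) (hhT : layerDepth a η ≤ 1 / 2) :
    windowDefectForm a (weilInteriorDefect a u η) ≤ cuspDefectBoundWith a C ω η := by
  have ha := hu.pos
  have hK0 := layerConstant_nonneg ha
  obtain ⟨ht2, hts, htE⟩ := weilInteriorDefect_finiteEnergy hu hη hη1
  have hq1 : 1 ≤ cuspRoot a η := one_le_cuspRoot ha hη hη1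
  have hq4 : cuspRoot a η ^ 4 = cuspLog a (layerDepth a η) := cuspRoot_pow_four ha hη hη1
  have hq2 : cuspRoot a η ^ 2 = Real.sqrt (cuspLog a (layerDepth a η)) := cuspRoot_sq a η
  set h := layerDepth a η with hh_def
  set t := weilInteriorDefect a u η with ht_def
  set q := cuspRoot a η with hq_def
  set K := layerConstant a with hK_def
  set G := cuspPrim a a with hG_def
  set W := ω (2 * a) with hW_def
  set w := ω (2 * h) with hw_def
  set Λ := cuspLog a h with hΛ_def
  have hh0 : 0 < h := layerDepth_pos ha hη
  have hha2 : h ≤ a / 2 := layerDepth_le_half ha.le hη.le hη1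
  have hha : h ≤ a := by linarith
  have hq0 : 0 < q := by linarith
  have hG0 : 0 ≤ G := cuspPrim_nonneg _ _
  have hW0 : 0 ≤ W := hR.modulus_nonneg (by linarith)
  have hw0 : 0 ≤ w := hR.modulus_nonneg (by linarith)
  -- step 1: near / far split of the window form
  have hmin : h ≤ min a 1 / 2 := by
    rw [le_div_iff₀ two_pos]
    exact le_min (by linarith) (by linarith)
  have h1 := windowDefectForm_le_near_add ha ht2 hts rfl hh0 hmin htE
  -- step 2: the near arch from the increments
  set Φ := cuspNearRate a C ω η with hΦ_def
  have hΦ0 : 0 ≤ Φ := cuspNearRate_nonneg hR hC0 ha hη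
  have hD : ∀ s, 0 < s → s ≤ h → weilIncrement t s ≤ s * Φ := fun s hs hsh ↦
    weilIncrement_weilInteriorDefect_le_with hC hR hC0 ha hη hη1 hs hsh
  have h2 := setIntegral_arch_near_le hh0 (by linarith) hΦ0 hD
    (htE.mono_set Ioc_subset_Ioi_self)
  have h2' : ∫ s in Ioc 0 h, weilArchDensity s * weilIncrement t s ≤ h * Φ := by
    refine h2.trans ?_
    calc h * (1 / 2 + h) * Φ = h * ((1 / 2 + h) * Φ) := by ring
      _ ≤ h * (1 * Φ) :=
          mul_le_mul_of_nonneg_left (mul_le_mul_of_nonneg_right (by linarith) hΦ0) hh0.le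
      _ = h * Φ := by ring
  -- step 3: the mass with the split scale `δ = h/q`
  set δ := h / q with hδ_def
  have hδ0 : 0 < δ := div_pos hh0 hq0
  have hδh : δ ≤ h := div_le_self hh0.le hq1
  have h3 := integral_norm_sq_weilInteriorDefect_le_with hC hR hC0 ha hη hη1 hδ0 hδh
  have hS : h * cuspWeight a δ ≤ 1 / q ^ 5 := by
    have hL : Λ ≤ cuspLog a δ := cuspLog_antitone a hδ0 hδh
    have hsq : Real.sqrt Λ ≤ Real.sqrt (cuspLog a δ) := Real.sqrt_le_sqrt hL
    have hΛ0 : 0 ≤ Λ := (cuspLog_pos hh0 hha).le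
    have hprod : h * q ^ 5 ≤ δ * (cuspLog a δ * Real.sqrt (cuspLog a δ)) := by
      have e : h * q ^ 5 = δ * (q ^ 4 * q ^ 2) := by
        rw [hδ_def]; field_simp
      rw [e, hq4, hq2]
      exact mul_le_mul_of_nonneg_left (mul_le_mul hL hsq (Real.sqrt_nonneg _)
        (hΛ0.trans hL)) hδ0.le
    have hpos : 0 < h * q ^ 5 := by positivity
    calc h * cuspWeight a δ = h * (1 / (δ * (cuspLog a δ * Real.sqrt (cuspLog a δ)))) := rfl
      _ ≤ h * (1 / (h * q ^ 5)) :=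
          mul_le_mul_of_nonneg_left (one_div_le_one_div_of_le hpos hprod) hh0.le
      _ = 1 / q ^ 5 := by field_simp
  have hGh : cuspPrim a h ^ 2 = 4 / q ^ 4 := by rw [hq4]; exact cuspPrim_sq hh0 hha
  -- the mass in terms of `q`
  set P := 6 * C ^ 2 * G + 96 * C ^ 2 with hP_def
  have hP0 : 0 ≤ P := by positivity
  set A₁ := 6 * a * η ^ 2 * (C * G + W) ^ 2 + 6 * h * w * W with hA₁_def
  have hA₁0 : 0 ≤ A₁ := by positivity
  have hm : ∫ x, ‖t x‖ ^ 2 ≤ A₁ + P * h / q ^ 5 := by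
    clear h1 h2 h2' hD
    have e1 : 6 * C ^ 2 * (h * cuspWeight a δ) * (h * G) ≤ 6 * C ^ 2 * (1 / q ^ 5) * (h * G) :=
      mul_le_mul_of_nonneg_right (mul_le_mul_of_nonneg_left hS (by positivity)) (by positivity)
    have e2 : 24 * C ^ 2 * cuspPrim a h ^ 2 * δ = 96 * C ^ 2 * h / q ^ 5 := by
      rw [hGh, hδ_def]; field_simp; ring
    have e3 : 6 * C ^ 2 * (1 / q ^ 5) * (h * G) + 96 * C ^ 2 * h / q ^ 5 = P * h / q ^ 5 := by
      rw [hP_def]; field_simp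
    linarith only [h3, e1, e2, e3]
  -- step 4: `(2ℓ + 2K)·mass`
  have hℓ0 : 0 ≤ Real.log (1 / h) := Real.log_nonneg (by rw [le_div_iff₀ hh0]; linarith)
  have hℓΛ : Real.log (1 / h) ≤ q ^ 4 := by rw [hq4]; exact log_one_div_le_cuspLog a hh0
  have hw5 : 0 ≤ P * h / q ^ 5 := by positivity
  have h4 : (2 * Real.log (1 / h) + 2 * K) * ∫ x, ‖t x‖ ^ 2 ≤
      (2 * Real.log (1 / h) + 2 * K) * A₁ + (2 * q ^ 4 + 2 * K) * (P * h / q ^ 5) := by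
    have s1 := mul_le_mul_of_nonneg_left hm (by linarith : 0 ≤ 2 * Real.log (1 / h) + 2 * K)
    have s2 : (2 * Real.log (1 / h) + 2 * K) * (P * h / q ^ 5) ≤
        (2 * q ^ 4 + 2 * K) * (P * h / q ^ 5) :=
      mul_le_mul_of_nonneg_right (by linarith) hw5
    have e : (2 * Real.log (1 / h) + 2 * K) * (A₁ + P * h / q ^ 5) =
        (2 * Real.log (1 / h) + 2 * K) * A₁ + (2 * Real.log (1 / h) + 2 * K) * (P * h / q ^ 5) := by
      ring
    linarith only [s1, s2, e]
  have h5 : (2 * q ^ 4 + 2 * K) * (P * h / q ^ 5) ≤ (2 + 2 * K) * P * (h / q) := by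
    rw [show (2 * q ^ 4 + 2 * K) * (P * h / q ^ 5) = (2 + 2 * K / q ^ 4) * (P * (h / q)) by
      field_simp]
    have hK : 2 * K / q ^ 4 ≤ 2 * K := div_le_self (by positivity) (one_le_pow₀ hq1)
    have hw : 0 ≤ P * (h / q) := by positivity
    calc (2 + 2 * K / q ^ 4) * (P * (h / q)) ≤ (2 + 2 * K) * (P * (h / q)) :=
          mul_le_mul_of_nonneg_right (by linarith only [hK]) hw
      _ = (2 + 2 * K) * P * (h / q) := by ring
  -- assemble
  have hfin : windowDefectForm a t ≤ h * Φ + (2 * Real.log (1 / h) + 2 * K) * A₁ +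
      (2 + 2 * K) * P * (h / q) := by
    linarith only [h1, h2', h4, h5]
  unfold cuspDefectBoundWith
  rw [← hh_def, ← hq_def, ← hK_def, ← hG_def, ← hW_def, ← hw_def, ← hΦ_def]
  convert hfin using 2

/-! ## The bound is `o(η)` -/

/-- `2h(η) → 0⁺` as `η → 0⁺`. [folklore] -/
theorem tendsto_two_mul_layerDepth (ha : 0 < a) :
    Tendsto (fun η ↦ 2 * layerDepth a η) (𝓝[>] 0) (𝓝[>] 0) := by
  have hh := tendsto_nhdsWithin_iff.1 (tendsto_layerDepth ha)
  refine tendsto_nhdsWithin_iff.2 ⟨?_, ?_⟩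
  · simpa using hh.1.const_mul 2
  · filter_upwards [hh.2] with η hη
    rw [mem_Ioi] at hη ⊢
    linarith

/-- **The Dini–log condition at the layer scale**: `log(1/h(η)) · ω(2h(η)) → 0` as `η → 0⁺`.
[folklore] -/
theorem tendsto_log_mul_modulus_layerDepth {Ξ ω : ℝ → ℝ} (hR : IsCuspRemainder Ξ ω)
    (ha : 0 < a) :
    Tendsto (fun η ↦ Real.log (1 / layerDepth a η) * ω (2 * layerDepth a η)) (𝓝[>] 0)
      (𝓝 0) := by
  have h2h := tendsto_two_mul_layerDepth ha
  have hA : Tendsto (fun η ↦ ω (2 * layerDepth a η) * Real.log (1 / (2 * layerDepth a η)))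
      (𝓝[>] 0) (𝓝 0) := hR.dini.comp h2h
  have hB : Tendsto (fun η ↦ ω (2 * layerDepth a η)) (𝓝[>] 0) (𝓝 0) :=
    hR.tendsto_modulus.comp h2h
  have T := hA.add (hB.mul_const (Real.log 2))
  simp only [zero_mul, add_zero] at T
  refine T.congr' ?_
  filter_upwards [self_mem_nhdsWithin] with η hη
  rw [mem_Ioi] at hη
  have hh0 := layerDepth_pos ha hη
  have e : Real.log (1 / layerDepth a η) = Real.log (1 / (2 * layerDepth a η)) + Real.log 2 := by
    rw [← Real.log_mul (by positivity) (by norm_num)]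
    congr 1
    field_simp
  rw [e]
  ring

/-- **The defect bound is `o(η)`**: `cuspDefectBoundWith a C ω η / η → 0` as `η → 0⁺`
(`h/η → a`, `Φ(η) → 0`, `η log(1/h) → 0`, `ω(2h) log(1/h) → 0`, `q → ∞`). [folklore] -/
theorem tendsto_cuspDefectBoundWith_div {Ξ ω : ℝ → ℝ} (hR : IsCuspRemainder Ξ ω) (ha : 0 < a)
    (C : ℝ) : Tendsto (fun η ↦ cuspDefectBoundWith a C ω η / η) (𝓝[>] 0) (𝓝 0) := by
  have hhd := tendsto_layerDepth_div a
  have hΦ := tendsto_cuspNearRate (C := C) hR ha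
  have hℓ := tendsto_mul_log_inv_layerDepth ha
  have hℓw := tendsto_log_mul_modulus_layerDepth hR ha
  have hw : Tendsto (fun η ↦ ω (2 * layerDepth a η)) (𝓝[>] 0) (𝓝 0) :=
    hR.tendsto_modulus.comp (tendsto_two_mul_layerDepth ha)
  have hq : Tendsto (fun η ↦ (cuspRoot a η)⁻¹) (𝓝[>] 0) (𝓝 0) :=
    tendsto_inv_atTop_zero.comp (tendsto_cuspRoot_atTop ha)
  have hid : Tendsto (fun η : ℝ ↦ η) (𝓝[>] 0) (𝓝 0) :=
    tendsto_id.mono_left nhdsWithin_le_nhds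
  set G := cuspPrim a a
  set K := layerConstant a
  set W := ω (2 * a)
  have T1 := hhd.mul hΦ
  have T2 := ((hℓ.const_mul 2).add (hid.const_mul (2 * K))).mul_const (6 * a * (C * G + W) ^ 2)
  have T3 := ((hℓw.const_mul 2).add (hw.const_mul (2 * K))).mul (hhd.mul_const (6 * W))
  have T4 := (hhd.mul hq).const_mul ((2 + 2 * K) * (6 * C ^ 2 * G + 96 * C ^ 2))
  have T := ((T1.add T2).add T3).add T4
  simp only [mul_zero, zero_mul, add_zero] at T
  refine T.congr' ?_
  filter_upwards [Ioc_mem_nhdsGT one_pos] with η hη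
  have hη0 : 0 < η := hη.1
  have hq0 : cuspRoot a η ≠ 0 := by linarith [one_le_cuspRoot ha hη.1 hη.2]
  have hη' : η ≠ 0 := hη0.ne'
  simp only [cuspDefectBoundWith]
  field_simp
  ring

/-! ## (R3) and the log-Pohozaev identity from a cusp modulus with remainder -/

/-- **Cusp modulus with remainder ⇒ (R3).** A Weil ground state whose open-window truncation is
Lipschitz in the cusp coordinate up to a monotone remainder with Dini–log modulus has an `o(η)`
interior dilation defect: `D_a(t_η)/η → 0`. The gen-6 theorem
`hasInteriorRegularDefect_of_cuspModulus` is the case `Ξ = 0`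
(`hC.hasCuspModulusWith`, `IsCuspRemainder.zero`). [cite: Bombieri2000Weil, §4 Thm 5, §6] -/
theorem hasInteriorRegularDefect_of_cuspModulusWith (hu : IsWeilGroundState a u) {C : ℝ}
    {Ξ ω : ℝ → ℝ} (hC : HasCuspModulusWith a u C Ξ) (hR : IsCuspRemainder Ξ ω) :
    HasInteriorRegularDefect a u := by
  have ha := hu.pos
  have hC' := hC.max_zero
  have hC0 : 0 ≤ max C 0 := le_max_right _ _
  have hpos : (0 : ℝ) < min 1 (1 / (2 * a)) := lt_min one_pos (by positivity)
  unfold HasInteriorRegularDefect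
  refine tendsto_of_tendsto_of_tendsto_of_le_of_le' tendsto_const_nhds
    (tendsto_cuspDefectBoundWith_div hR ha (max C 0)) ?_ ?_
  · filter_upwards [Ioc_mem_nhdsGT hpos] with η hη
    have hη1 : η ≤ 1 := hη.2.trans (min_le_left _ _)
    exact div_nonneg (windowDefectForm_weilInteriorDefect_nonneg hu hη.1 hη1) hη.1.le
  · filter_upwards [Ioc_mem_nhdsGT hpos] with η hη
    have hη1 : η ≤ 1 := hη.2.trans (min_le_left _ _)
    have hh : layerDepth a η ≤ 1 / 2 := by
      have h1 := layerDepth_le_mul ha.le hη.1.le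
      have h2 : η ≤ 1 / (2 * a) := hη.2.trans (min_le_right _ _)
      have h3 : a * η ≤ a * (1 / (2 * a)) := mul_le_mul_of_nonneg_left h2 ha.le
      rw [show a * (1 / (2 * a)) = 1 / 2 by field_simp] at h3
      linarith
    exact div_le_div_of_nonneg_right
      (windowDefectForm_weilInteriorDefect_le_with hu hC' hR hC0 hη.1 hη1 hh) hη.1.le

/-- **The log-Pohozaev identity under a cusp modulus with remainder**: at a differentiability
window `a` of `ε`, `V = 2c₀·a·I`. [cite: Bombieri2000Weil, §4 Thm 3, §6] -/
theorem virial_eq_of_cuspModulusWith (hu : IsWeilGroundState a u) {C : ℝ} {Ξ ω : ℝ → ℝ}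
    (hC : HasCuspModulusWith a u C Ξ) (hR : IsCuspRemainder Ξ ω)
    (hd : DifferentiableAt ℝ weilGroundEnergy a) {V I : ℝ}
    (hV : HasDerivAt (weilDilationProfile a u) V 0) (hI : HasEdgeIntensity u a I) :
    V = 2 * edgeLawKernelConstant * a * I :=
  virial_eq_of_interiorRegular hu hd hV hI (hasInteriorRegularDefect_of_cuspModulusWith hu hC hR)

/-- **Two-sided edge law under a cusp modulus with remainder**: `ε'(a) = −2c₀·I(u)` at a
differentiability window. [cite: Bombieri2000Weil, §6] -/
theorem deriv_weilGroundEnergy_eq_of_cuspModulusWith (hu : IsWeilGroundState a u) {C : ℝ}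
    {Ξ ω : ℝ → ℝ} (hC : HasCuspModulusWith a u C Ξ) (hR : IsCuspRemainder Ξ ω)
    (hd : DifferentiableAt ℝ weilGroundEnergy a) {V I : ℝ}
    (hV : HasDerivAt (weilDilationProfile a u) V 0) (hI : HasEdgeIntensity u a I) :
    deriv weilGroundEnergy a = -(2 * edgeLawKernelConstant * I) :=
  deriv_weilGroundEnergy_eq_of_interiorRegular hu hd hV hI
    (hasInteriorRegularDefect_of_cuspModulusWith hu hC hR)

/-- **R6 from cusp moduli with remainder at differentiability windows**: if every ground state of
the window `a` admits a cusp modulus with remainder and `ε` is differentiable at `a`, then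
`WeilLogPohozaevAt a`. [cite: Bombieri2000Weil, §4 Thm 3] -/
theorem weilLogPohozaevAt_of_cuspModulusWith
    (hmod : ∀ u : ℝ → ℂ, IsWeilGroundState a u →
      ∃ C : ℝ, ∃ Ξ ω : ℝ → ℝ, HasCuspModulusWith a u C Ξ ∧ IsCuspRemainder Ξ ω)
    (hd : DifferentiableAt ℝ weilGroundEnergy a) : WeilLogPohozaevAt a :=
  weilLogPohozaevAt_of_interiorRegular
    (fun u hu ↦ by
      obtain ⟨C, Ξ, ω, hC, hR⟩ := hmod u hu
      exact hasInteriorRegularDefect_of_cuspModulusWith hu hC hR) hd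

/-- **(R2′) under a cusp modulus with remainder**: the corner energy is `o(h)` at
differentiability windows. [folklore] -/
theorem tendsto_cornerEnergy_div_zero_of_cuspModulusWith (hu : IsWeilGroundState a u) {C : ℝ}
    {Ξ ω : ℝ → ℝ} (hC : HasCuspModulusWith a u C Ξ) (hR : IsCuspRemainder Ξ ω)
    (hd : DifferentiableAt ℝ weilGroundEnergy a) {V I : ℝ}
    (hV : HasDerivAt (weilDilationProfile a u) V 0) (hI : HasEdgeIntensity u a I) :
    Tendsto (fun h ↦ cornerEnergy a u h / h) (𝓝[>] 0) (𝓝 0) :=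
  tendsto_cornerEnergy_div_zero_of_interiorRegular hu hd hV hI
    (hasInteriorRegularDefect_of_cuspModulusWith hu hC hR)

end Summit.RiemannHypothesis.RiemannHypothesis.Theorems.PfPersistence

end
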